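import Mathlib
import Literature.MathematicalPhysics.QuantumManyBody.BoseEinsteinCondensation
import Literature.MathematicalPhysics.QuantumManyBody.NeumannBoxParseval
import Literature.MathematicalPhysics.QuantumManyBody.BoseGasProductState
import Summits.AtomisticToContinuum.BoseEinsteinCondensation.Theorems.SoloBlindTrialStateCriterion

/-!
# Neumann-mode occupations of a Dirichlet trial state

Solo seat `solo-AtomisticToContinuum-blind`, conjunct `BoseEinsteinCondensation`.

We expand the one-particle slices `x ↦ Ψ(x, Y)` of an `(n+1)`-boson Dirichlet trial state in the
Neumann cosine eigenbasis `u_k`, `k ∈ ℕ₀³`, of the box `Λ_L` (`NeumannBox.mode`; `u_0 = L^{-3/2}` is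
the flat condensate mode) and write `N_k(Ψ) = (n+1) ∫ dY |⟨u_k, Ψ(·, Y)⟩|²` for the occupation of
the mode `u_k` (the diagonal of the one-particle density matrix in this basis).  We prove:

* `sum_inv_norm_le` : the lattice-sum estimate `∑_{k ∈ {0,…,M}³} 1/|k| ≤ 7 M²` in dimension three
  (induction on shells; used by the infrared criterion `SoloBlindInfraredBEC`);
* `tsum_modeOccupation_eq` : `∑_k N_k(Ψ) = n + 1` (Parseval on every slice);
* `lintegral_kineticDensity_eq` : `∫ |∇Ψ|² = (n+1) ∫ ∑ᵢ |∂_{0,i}Ψ|²` — by Bose symmetry the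
  kinetic energy is equidistributed over the particles;
* `tsum_waveNumber_sq_mul_modeOccupation_le` : `∑_k (π/L)²|k|² N_k(Ψ) ≤ ∫ |∇Ψ|²` (the Neumann
  form is diagonal in `u_k` on every slice).
-/

noncomputable section

open MeasureTheory Filter Set
open scoped ENNReal NNReal Real

namespace Summit.AtomisticToContinuum.BoseEinsteinCondensation.Theorems

open Literature.MathematicalPhysics.QuantumManyBody.BoseGas
open Literature.MathematicalPhysics.QuantumManyBody.NeumannBox

/-! ### The lattice sum `∑_{k ∈ {0,…,M}³} 1/|k| ≤ 7M²` -/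

/-- On the shell `{0,…,M+1}³ ∖ {0,…,M}³` some coordinate equals `M+1`, so `1/|k| ≤ 1/(M+1)`. -/
theorem one_div_norm_le_of_mem_sdiff {M : ℕ} {k : Fin 3 → ℕ}
    (hk : k ∈ Fintype.piFinset (fun _ : Fin 3 => Finset.range (M + 2)) \
      Fintype.piFinset (fun _ : Fin 3 => Finset.range (M + 1))) :
    1 / Real.sqrt (∑ i, ((k i : ℕ) : ℝ) ^ 2) ≤ 1 / ((M : ℝ) + 1) := by
  rw [Finset.mem_sdiff, Fintype.mem_piFinset, Fintype.mem_piFinset] at hk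
  obtain ⟨-, h2⟩ := hk
  push Not at h2
  obtain ⟨i, hi⟩ := h2
  rw [Finset.mem_range, not_lt] at hi
  have hi' : (M : ℝ) + 1 ≤ (k i : ℝ) := by exact_mod_cast hi
  have hle : ((M : ℝ) + 1) ^ 2 ≤ ∑ j, ((k j : ℕ) : ℝ) ^ 2 := by
    calc ((M : ℝ) + 1) ^ 2 ≤ ((k i : ℕ) : ℝ) ^ 2 := by gcongr
      _ ≤ ∑ j, ((k j : ℕ) : ℝ) ^ 2 :=
        Finset.single_le_sum (f := fun j => ((k j : ℕ) : ℝ) ^ 2) (fun j _ => sq_nonneg _)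
          (Finset.mem_univ i)
  have hpos : (0 : ℝ) < (M : ℝ) + 1 := by positivity
  gcongr
  calc (M : ℝ) + 1 = Real.sqrt (((M : ℝ) + 1) ^ 2) := (Real.sqrt_sq hpos.le).symm
    _ ≤ Real.sqrt (∑ j, ((k j : ℕ) : ℝ) ^ 2) := Real.sqrt_le_sqrt hle

/-- **The three-dimensional lattice sum** `∑_{k ∈ {0,…,M}³} 1/|k| ≤ 7 M²` (the term `k = 0` is
`1/0 = 0`).  By induction on shells: the shell `max kᵢ = M+1` has `(M+2)³ - (M+1)³` points, each
contributing at most `1/(M+1)`. -/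
theorem sum_inv_norm_le (M : ℕ) :
    ∑ k ∈ Fintype.piFinset (fun _ : Fin 3 => Finset.range (M + 1)),
        1 / Real.sqrt (∑ i, ((k i : ℕ) : ℝ) ^ 2) ≤ 7 * (M : ℝ) ^ 2 := by
  induction M with
  | zero =>
    have h0 : Fintype.piFinset (fun _ : Fin 3 => Finset.range (0 + 1)) = {0} := by
      ext k
      simp only [zero_add, Fintype.mem_piFinset, Finset.range_one, Finset.mem_singleton,
        funext_iff, Pi.zero_apply]
    rw [h0, Finset.sum_singleton]
    simp
  | succ M ih =>
    have hsub : Fintype.piFinset (fun _ : Fin 3 => Finset.range (M + 1)) ⊆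
        Fintype.piFinset (fun _ : Fin 3 => Finset.range (M + 1 + 1)) :=
      Fintype.piFinset_subset _ _ fun _ => Finset.range_subset_range.mpr (by omega)
    rw [← Finset.sum_sdiff hsub]
    have hcard : (((Fintype.piFinset (fun _ : Fin 3 => Finset.range (M + 1 + 1)) \
        Fintype.piFinset (fun _ : Fin 3 => Finset.range (M + 1))).card : ℕ) : ℝ) =
        ((M : ℝ) + 2) ^ 3 - ((M : ℝ) + 1) ^ 3 := by
      rw [Finset.card_sdiff_of_subset hsub, Fintype.card_piFinset, Fintype.card_piFinset]
      simp only [Finset.card_range, Finset.prod_const, Finset.card_univ, Fintype.card_fin]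
      have hle : (M + 1) ^ 3 ≤ (M + 1 + 1) ^ 3 := Nat.pow_le_pow_left (by omega) 3
      rw [Nat.cast_sub hle]
      push_cast
      ring
    have hshell : ∑ k ∈ Fintype.piFinset (fun _ : Fin 3 => Finset.range (M + 1 + 1)) \
        Fintype.piFinset (fun _ : Fin 3 => Finset.range (M + 1)),
        1 / Real.sqrt (∑ i, ((k i : ℕ) : ℝ) ^ 2) ≤
        (((M : ℝ) + 2) ^ 3 - ((M : ℝ) + 1) ^ 3) * (1 / ((M : ℝ) + 1)) := by
      rw [← hcard]
      have := Finset.sum_le_card_nsmul _ _ (1 / ((M : ℝ) + 1))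
        (fun k hk => one_div_norm_le_of_mem_sdiff hk)
      simpa [nsmul_eq_mul] using this
    have hpos : (0 : ℝ) < (M : ℝ) + 1 := by positivity
    calc _ ≤ (((M : ℝ) + 2) ^ 3 - ((M : ℝ) + 1) ^ 3) * (1 / ((M : ℝ) + 1)) + 7 * (M : ℝ) ^ 2 :=
          add_le_add hshell ih
      _ = (3 * ((M : ℝ) + 1) + 3 + 1 / ((M : ℝ) + 1)) + 7 * (M : ℝ) ^ 2 := by
          field_simp
          ring
      _ ≤ (3 * ((M : ℝ) + 1) + 3 + 1) + 7 * (M : ℝ) ^ 2 := by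
          gcongr
          rw [div_le_one hpos]
          linarith [(Nat.cast_nonneg M : (0 : ℝ) ≤ M)]
      _ ≤ 7 * ((M + 1 : ℕ) : ℝ) ^ 2 := by
          push_cast
          nlinarith [(Nat.cast_nonneg M : (0 : ℝ) ≤ M)]

/-! ### One-particle slices of a trial state in the Neumann eigenbasis -/

section Slices

variable {n : ℕ} {L : ℝ}

/-- The linear part `u ↦ u :: 0` of the affine slice map `x ↦ x :: Y`. -/
theorem consCLM_apply (u : Space) :
    (ContinuousLinearMap.pi fun i : Fin (n + 1) =>
        (Fin.cases (ContinuousLinearMap.id ℝ Space) (fun _ : Fin n => (0 : Space →L[ℝ] Space)) i :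
          Space →L[ℝ] Space)) u =
      (Pi.single (0 : Fin (n + 1)) u : Fin (n + 1) → Space) := by
  funext i
  refine Fin.cases ?_ (fun j => ?_) i
  · simp
  · simp [Fin.succ_ne_zero]

/-- `x :: Y = (x :: 0) + (0 :: Y)`: the slice map is affine. -/
theorem vecCons_eq_consCLM_add (Y : Config n) (x : Space) :
    (Matrix.vecCons x Y : Config (n + 1)) =
      (ContinuousLinearMap.pi fun i : Fin (n + 1) =>
        (Fin.cases (ContinuousLinearMap.id ℝ Space) (fun _ : Fin n => (0 : Space →L[ℝ] Space)) i :
          Space →L[ℝ] Space)) x + Matrix.vecCons (0 : Space) Y := by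
  funext i
  refine Fin.cases ?_ (fun j => ?_) i
  · simp
  · simp

/-- The map `x ↦ x :: Y` has derivative `u ↦ u :: 0 = Pi.single 0 u`. -/
theorem hasFDerivAt_vecCons (Y : Config n) (x : Space) :
    HasFDerivAt (fun x : Space => (Matrix.vecCons x Y : Config (n + 1)))
      (ContinuousLinearMap.pi fun i : Fin (n + 1) =>
        (Fin.cases (ContinuousLinearMap.id ℝ Space) (fun _ : Fin n => (0 : Space →L[ℝ] Space)) i :
          Space →L[ℝ] Space)) x := by
  have hfun : (fun x : Space => (Matrix.vecCons x Y : Config (n + 1))) = fun x =>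
      (ContinuousLinearMap.pi fun i : Fin (n + 1) =>
        (Fin.cases (ContinuousLinearMap.id ℝ Space) (fun _ : Fin n => (0 : Space →L[ℝ] Space)) i :
          Space →L[ℝ] Space)) x + Matrix.vecCons (0 : Space) Y :=
    funext (vecCons_eq_consCLM_add Y)
  rw [hfun]
  exact (ContinuousLinearMap.hasFDerivAt _).add_const _

/-- The slice `x ↦ Ψ(x, Y)` is `C¹`. -/
theorem contDiff_slice (Ψ : TrialState (n + 1) L) (Y : Config n) :
    ContDiff ℝ 1 fun x : Space => Ψ.ψ (Matrix.vecCons x Y) := by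
  refine Ψ.contDiff.comp ?_
  have h : (fun x : Space => (Matrix.vecCons x Y : Config (n + 1))) = fun x =>
      (ContinuousLinearMap.pi fun i : Fin (n + 1) =>
        (Fin.cases (ContinuousLinearMap.id ℝ Space) (fun _ : Fin n => (0 : Space →L[ℝ] Space)) i :
          Space →L[ℝ] Space)) x + Matrix.vecCons (0 : Space) Y :=
    funext (vecCons_eq_consCLM_add Y)
  rw [h]
  exact (ContinuousLinearMap.contDiff _).add contDiff_const

/-- The map `(Y, x) ↦ x :: Y` is continuous. -/
theorem continuous_vecCons_swap :
    Continuous fun p : Config n × Space => (Matrix.vecCons p.2 p.1 : Config (n + 1)) := by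
  have h : Continuous fun p : Config n × Space => (Fin.cons p.2 p.1 : Fin (n + 1) → Space) :=
    Continuous.finCons (A := fun _ : Fin (n + 1) => Space) continuous_snd continuous_fst
  exact h

/-- Chain rule for the slice: `∂_u [x ↦ Ψ(x, Y)] = (∇Ψ)(x, Y) · (Pi.single 0 u)`. -/
theorem fderiv_slice_apply (Ψ : TrialState (n + 1) L) (Y : Config n) (x u : Space) :
    fderiv ℝ (fun x : Space => Ψ.ψ (Matrix.vecCons x Y)) x u =
      fderiv ℝ Ψ.ψ (Matrix.vecCons x Y) (Pi.single (0 : Fin (n + 1)) u : Fin (n + 1) → Space) := by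
  have hΨ : HasFDerivAt Ψ.ψ (fderiv ℝ Ψ.ψ (Matrix.vecCons x Y)) (Matrix.vecCons x Y) :=
    ((Ψ.contDiff.differentiable one_ne_zero) _).hasFDerivAt
  have h : HasFDerivAt (fun x : Space => Ψ.ψ (Matrix.vecCons x Y))
      ((fderiv ℝ Ψ.ψ (Matrix.vecCons x Y)).comp
        (ContinuousLinearMap.pi fun i : Fin (n + 1) =>
          (Fin.cases (ContinuousLinearMap.id ℝ Space) (fun _ : Fin n => (0 : Space →L[ℝ] Space)) i :
            Space →L[ℝ] Space))) x :=
    hΨ.comp x (hasFDerivAt_vecCons Y x)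
  rw [h.fderiv, ContinuousLinearMap.comp_apply, consCLM_apply]

/-- **Parseval on a slice**: `∑_k |⟨u_k, Ψ(·,Y)⟩|² = ∫ |Ψ(x,Y)|² dx`. -/
theorem tsum_enorm_sq_coef_eq (hL : 0 < L) (Ψ : TrialState (n + 1) L) (Y : Config n) :
    ∑' k : Fin 3 → ℕ, ‖∫ x in box L, (mode L k x : ℂ) * Ψ.ψ (Matrix.vecCons x Y)‖ₑ ^ 2 =
      ∫⁻ x, ‖Ψ.ψ (Matrix.vecCons x Y)‖ₑ ^ 2 := by
  rw [tsum_enorm_sq_setIntegral_box_mode_mul hL (contDiff_slice Ψ Y).continuous]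
  refine setLIntegral_eq_of_support_subset fun x hx => ?_
  by_contra hxb
  have h0 : Ψ.ψ (Matrix.vecCons x Y) = 0 := Ψ.eq_zero _ fun h => hxb (by simpa using h 0)
  exact hx (by simp [h0])

/-- **The Neumann form on a slice is diagonal**, bounded by the slice's kinetic energy density of
particle `0`: `∑_k (π/L)²|k|² |⟨u_k, Ψ(·,Y)⟩|² ≤ ∫ ∑ᵢ |∂_{0,i}Ψ(x,Y)|² dx`. -/
theorem tsum_waveNumber_sq_mul_enorm_sq_coef_le (hL : 0 < L) (Ψ : TrialState (n + 1) L)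
    (Y : Config n) :
    ∑' k : Fin 3 → ℕ, ENNReal.ofReal (∑ i, waveNumber L (k i) ^ 2) *
        ‖∫ x in box L, (mode L k x : ℂ) * Ψ.ψ (Matrix.vecCons x Y)‖ₑ ^ 2 ≤
      ∫⁻ x, ∑ i : Fin 3, ‖fderiv ℝ Ψ.ψ (Matrix.vecCons x Y)
        (Pi.single (0 : Fin (n + 1)) (EuclideanSpace.single i (1 : ℝ)))‖ₑ ^ 2 := by
  rw [tsum_sum_waveNumber_sq_mul_enorm_sq_setIntegral_box_mode_mul hL (contDiff_slice Ψ Y)]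
  simp_rw [fderiv_slice_apply]
  exact setLIntegral_le_lintegral _ _

/-- The mode coefficients `Y ↦ ⟨u_k, Ψ(·,Y)⟩` are measurable. -/
theorem measurable_enorm_sq_coef (Ψ : TrialState (n + 1) L) (k : Fin 3 → ℕ) :
    Measurable fun Y : Config n =>
      ‖∫ x in box L, (mode L k x : ℂ) * Ψ.ψ (Matrix.vecCons x Y)‖ₑ ^ 2 := by
  have hmode : Continuous (mode L k) :=
    continuous_finsetProd _ fun i _ =>
      (contDiff_cosMode L (k i) (k := 0)).continuous.comp (PiLp.continuous_apply 2 _ i)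
  have hF : Continuous fun p : Config n × Space =>
      (mode L k p.2 : ℂ) * Ψ.ψ (Matrix.vecCons p.2 p.1) :=
    (Complex.continuous_ofReal.comp (hmode.comp continuous_snd)).mul
      (Ψ.contDiff.continuous.comp continuous_vecCons_swap)
  have hsm : StronglyMeasurable fun Y : Config n =>
      ∫ x in box L, (mode L k x : ℂ) * Ψ.ψ (Matrix.vecCons x Y) :=
    hF.stronglyMeasurable.integral_prod_right' (ν := volume.restrict (box L))
  exact hsm.measurable.enorm.pow_const 2

/-- **`∑_k N_k(Ψ) = n + 1`**: the mode occupations of a normalised `(n+1)`-particle trial state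
sum to the particle number. -/
theorem tsum_modeOccupation_eq (hL : 0 < L) (Ψ : TrialState (n + 1) L) :
    ∑' k : Fin 3 → ℕ, (n + 1 : ℝ≥0∞) *
        ∫⁻ Y : Config n, ‖∫ x in box L, (mode L k x : ℂ) * Ψ.ψ (Matrix.vecCons x Y)‖ₑ ^ 2 =
      (n + 1 : ℝ≥0∞) := by
  rw [ENNReal.tsum_mul_left, ← lintegral_tsum fun k => (measurable_enorm_sq_coef Ψ k).aemeasurable]
  simp_rw [tsum_enorm_sq_coef_eq hL Ψ]
  rw [← lintegral_eq_lintegral_lintegral_vecCons (F := fun X => ‖Ψ.ψ X‖ₑ ^ 2)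
    (Ψ.contDiff.continuous.measurable.enorm.pow_const 2)]
  have h1 : ∫⁻ X, ‖Ψ.ψ X‖ₑ ^ 2 = 1 := by simpa [enorm_eq_nnnorm] using Ψ.norm_eq
  rw [h1, mul_one]

end Slices

/-! ### Bose symmetry equidistributes the kinetic energy over the particles -/

section Symmetry

variable {n : ℕ} {L : ℝ}

/-- Chain rule for a relabelling of the particles: `DΨ(X)·V = DΨ(X ∘ σ)·(V ∘ σ)` for a
Bose-symmetric `Ψ`. -/
theorem fderiv_apply_eq_fderiv_comp_perm (Ψ : TrialState (n + 1) L)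
    (σ : Equiv.Perm (Fin (n + 1))) (X V : Config (n + 1)) :
    fderiv ℝ Ψ.ψ X V = fderiv ℝ Ψ.ψ (X ∘ σ) (V ∘ σ) := by
  let P : Config (n + 1) →L[ℝ] Config (n + 1) :=
    ContinuousLinearMap.pi fun i => ContinuousLinearMap.proj (σ i)
  have hP : ∀ Z : Config (n + 1), P Z = Z ∘ σ := fun Z => rfl
  have hcomp : Ψ.ψ ∘ P = Ψ.ψ := by
    funext Z
    rw [Function.comp_apply, hP]
    exact Ψ.symm σ Z
  have hd : HasFDerivAt (Ψ.ψ ∘ P) ((fderiv ℝ Ψ.ψ (P X)).comp P) X :=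
    ((Ψ.contDiff.differentiable one_ne_zero) _).hasFDerivAt.comp X P.hasFDerivAt
  rw [hcomp] at hd
  rw [hd.fderiv, ContinuousLinearMap.comp_apply, hP, hP]

/-- For the transposition `σ = (0 j)`: `(Pi.single j u) ∘ σ = Pi.single 0 u`. -/
theorem single_comp_swap (j : Fin (n + 1)) (u : Space) :
    ((Pi.single j u : Fin (n + 1) → Space) ∘ (Equiv.swap (0 : Fin (n + 1)) j)) =
      (Pi.single (0 : Fin (n + 1)) u : Fin (n + 1) → Space) := by
  funext i
  rw [Function.comp_apply]
  by_cases hi : i = 0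
  · subst hi
    simp
  · have hne : Equiv.swap (0 : Fin (n + 1)) j i ≠ j := by
      intro h
      apply hi
      have h' := congrArg (Equiv.swap (0 : Fin (n + 1)) j) h
      rwa [Equiv.swap_apply_self, Equiv.swap_apply_right] at h'
    rw [Pi.single_eq_of_ne hne, Pi.single_eq_of_ne hi]

/-- **Equidistribution**: `∫ |∂_{j,u}Ψ|² = ∫ |∂_{0,u}Ψ|²` for a Bose-symmetric `Ψ`. -/
theorem lintegral_enorm_fderiv_single_sq_eq (Ψ : TrialState (n + 1) L) (j : Fin (n + 1))
    (u : Space) :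
    ∫⁻ X, ‖fderiv ℝ Ψ.ψ X (Pi.single j u : Fin (n + 1) → Space)‖ₑ ^ 2 =
      ∫⁻ X, ‖fderiv ℝ Ψ.ψ X (Pi.single (0 : Fin (n + 1)) u : Fin (n + 1) → Space)‖ₑ ^ 2 := by
  have h : ∀ X : Config (n + 1), fderiv ℝ Ψ.ψ X (Pi.single j u : Fin (n + 1) → Space) =
      fderiv ℝ Ψ.ψ (X ∘ Equiv.swap (0 : Fin (n + 1)) j)
        (Pi.single (0 : Fin (n + 1)) u : Fin (n + 1) → Space) := by
    intro X
    rw [fderiv_apply_eq_fderiv_comp_perm Ψ (Equiv.swap 0 j), single_comp_swap]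
  simp_rw [h]
  exact lintegral_comp_perm (Equiv.swap (0 : Fin (n + 1)) j)
    (fun X => ‖fderiv ℝ Ψ.ψ X (Pi.single (0 : Fin (n + 1)) u : Fin (n + 1) → Space)‖ₑ ^ 2)

/-- The partial derivatives of a trial state are measurable (indeed continuous). -/
theorem measurable_enorm_fderiv_sq (Ψ : TrialState (n + 1) L) (V : Config (n + 1)) :
    Measurable fun X : Config (n + 1) => ‖fderiv ℝ Ψ.ψ X V‖ₑ ^ 2 :=
  ((Ψ.contDiff.continuous_fderiv one_ne_zero).clm_apply continuous_const).measurable.enorm.pow_const 2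

/-- **`∫ |∇Ψ|² = (n+1) · ∫ ∑ᵢ |∂_{0,i}Ψ|²`**: by Bose symmetry the kinetic energy is carried
equally by all particles. -/
theorem lintegral_kineticDensity_eq (Ψ : TrialState (n + 1) L) :
    ∫⁻ X, kineticDensity Ψ.ψ X =
      (n + 1 : ℝ≥0∞) * ∫⁻ X, ∑ i : Fin 3, ‖fderiv ℝ Ψ.ψ X
        (Pi.single (0 : Fin (n + 1)) (EuclideanSpace.single i (1 : ℝ)))‖ₑ ^ 2 := by
  have hkin : ∀ X : Config (n + 1), kineticDensity Ψ.ψ X = ∑ j : Fin (n + 1), ∑ i : Fin 3,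
      ‖fderiv ℝ Ψ.ψ X (Pi.single j (EuclideanSpace.single i (1 : ℝ)))‖ₑ ^ 2 := fun X => rfl
  simp_rw [hkin]
  rw [lintegral_finsetSum _ fun j _ =>
    Finset.measurable_sum _ fun i _ => measurable_enorm_fderiv_sq Ψ _]
  rw [lintegral_finsetSum _ fun i _ => measurable_enorm_fderiv_sq Ψ _]
  have hj : ∀ j : Fin (n + 1), ∫⁻ X, ∑ i : Fin 3,
      ‖fderiv ℝ Ψ.ψ X (Pi.single j (EuclideanSpace.single i (1 : ℝ)))‖ₑ ^ 2 =
      ∑ i : Fin 3, ∫⁻ X, ‖fderiv ℝ Ψ.ψ X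
        (Pi.single (0 : Fin (n + 1)) (EuclideanSpace.single i (1 : ℝ)))‖ₑ ^ 2 := by
    intro j
    rw [lintegral_finsetSum _ fun i _ => measurable_enorm_fderiv_sq Ψ _]
    exact Finset.sum_congr rfl fun i _ => lintegral_enorm_fderiv_single_sq_eq Ψ j _
  rw [Finset.sum_congr rfl fun j _ => hj j, Finset.sum_const, Finset.card_univ, Fintype.card_fin,
    nsmul_eq_mul]
  push_cast
  ring

end Symmetry

/-! ### The kinetic energy controls the high modes -/

section Kinetic

variable {n : ℕ} {L : ℝ}

/-- **`∑_k (π/L)²|k|² N_k(Ψ) ≤ ∫ |∇Ψ|²`.** -/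
theorem tsum_waveNumber_sq_mul_modeOccupation_le (hL : 0 < L) (Ψ : TrialState (n + 1) L) :
    ∑' k : Fin 3 → ℕ, ENNReal.ofReal (∑ i, waveNumber L (k i) ^ 2) *
        ((n + 1 : ℝ≥0∞) * ∫⁻ Y : Config n,
          ‖∫ x in box L, (mode L k x : ℂ) * Ψ.ψ (Matrix.vecCons x Y)‖ₑ ^ 2) ≤
      ∫⁻ X, kineticDensity Ψ.ψ X := by
  calc ∑' k : Fin 3 → ℕ, ENNReal.ofReal (∑ i, waveNumber L (k i) ^ 2) *
        ((n + 1 : ℝ≥0∞) * ∫⁻ Y : Config n,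
          ‖∫ x in box L, (mode L k x : ℂ) * Ψ.ψ (Matrix.vecCons x Y)‖ₑ ^ 2)
      = (n + 1 : ℝ≥0∞) * ∫⁻ Y : Config n, ∑' k : Fin 3 → ℕ,
          ENNReal.ofReal (∑ i, waveNumber L (k i) ^ 2) *
            ‖∫ x in box L, (mode L k x : ℂ) * Ψ.ψ (Matrix.vecCons x Y)‖ₑ ^ 2 := by
        rw [lintegral_tsum fun k => ((measurable_enorm_sq_coef Ψ k).const_mul _).aemeasurable,
          ← ENNReal.tsum_mul_left]
        refine tsum_congr fun k => ?_
        rw [lintegral_const_mul _ (measurable_enorm_sq_coef Ψ k)]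
        ring
    _ ≤ (n + 1 : ℝ≥0∞) * ∫⁻ Y : Config n, ∫⁻ x, ∑ i : Fin 3, ‖fderiv ℝ Ψ.ψ (Matrix.vecCons x Y)
          (Pi.single (0 : Fin (n + 1)) (EuclideanSpace.single i (1 : ℝ)))‖ₑ ^ 2 :=
        by
          gcongr with Y
          exact tsum_waveNumber_sq_mul_enorm_sq_coef_le hL Ψ Y
    _ = ∫⁻ X, kineticDensity Ψ.ψ X := by
        rw [lintegral_kineticDensity_eq, ← lintegral_eq_lintegral_lintegral_vecCons
          (F := fun X : Config (n + 1) => ∑ i : Fin 3, ‖fderiv ℝ Ψ.ψ X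
            (Pi.single (0 : Fin (n + 1)) (EuclideanSpace.single i (1 : ℝ)))‖ₑ ^ 2)
          (Finset.measurable_sum _ fun i _ => measurable_enorm_fderiv_sq Ψ _)]

end Kinetic

end Summit.AtomisticToContinuum.BoseEinsteinCondensation.Theorems

end
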